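import Mathlib
import HarnessLib
import Summits.HubbardSuperconductivity.HubbardSuperconductivity.Theorems.KLProgrammeKLRegimeEnginePairTransferRungTwoShell
import Summits.HubbardSuperconductivity.HubbardSuperconductivity.Theorems.KLProgrammeKLRegimeEnginePairTransferDLineRoomReading
import Summits.HubbardSuperconductivity.HubbardSuperconductivity.Theorems.KLProgrammeKLRegimeEngineV8DefsG6Reading

/-!
# Route `KLProgramme` — ENGINE item stmt-HubbardSuperconductivity-20437 `KLRegimeEngineV17F2`, stub (c) value lane: the particle–particle rung mass at large total
# momentum, part 2 — REGIME READING against `klTwoShellProfile` and THE BOOKING into `(Klam U)²·klEngGeo11.ppGain` (cell gate-hubbard-kl, seat hubbard-kl-k3c2-p2 g18)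

Part 1 (`…PairTransferRungTwoShell`) proved `Σ_c klRungProfile … n ψ Qm c ≤ (108A/π²)·((2Λₙ+Gδ)/r + √(2Λₙ+Gδ))·((10+2Gβ/L)/π + 12G/(LΛₙ))` for
`0 < r ≤ |p_Qm|_𝕋`.  Here:
* §3 `klScale_lt_klTorusNorm_of_not_isPairClassAt` (`¬IsPairClassAt Qm m ⇒ Λₘ = 4^{-m}/32 < |p_Qm|_𝕋`); the REGIME READING **`sum_klRungProfile_le_profile`**:
  under `Gδ ≤ Λₙ₊₁`, `8Gβ ≤ L`, `1 ≤ n`, `Λₙ₊₁ ≤ |p_Qm|_𝕋`: `Σ_c klRungProfile … ≤ 2¹⁰·A·klTwoShellProfile (n+1) |p_Qm|_𝕋` (`(2Λₙ+Gδ) ≤ 9Λₙ₊₁`,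
  `(10+2Gβ/L)/π + 12G/(LΛₙ) ≤ 4`, `108/π² ≤ 12`, `Λₙ₊₁/ρ, √Λₙ₊₁ ≤ T_{n+1}(ρ)`); the package instance `sum_klRungProfile_compl_le_profile_klTS`
  (`A := klTS`, `u := klTSU`, out of class at `n+1`); **`rung_mass_le_ppGain_klEngGeo11`**: `m²·Σ_c klRungProfile … n s_{n+1,j} Qm c ≤ (Klam U)²·klEngGeo11.ppGain (n+1) |p_Qm|_𝕋`
  for every `m² ≤ 2⁵⁰·(Klam U)²` (`klTSA = 2⁶⁰·klTS`, `klTSA_twoShell_le_klEngGeo11_ppGain`); `…_of_regime` (`klBetaMin ≤ β`, `1 ≤ n ≤ n_β`, `8Gβ ≤ L`, via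
  `lattice_fattening_le_of_regime`);
* §4 the FLAT booking at the shallow scales (`two_pow_28_le_klEngGeo11_ppGain`: `2²⁸ ≤ klEngGeo11.ppGain m ρ` for `m ≤ 21`; `rung_mass_le_ppGain_klEngGeo11_flat`:
  every `Qm`, `n+1 ≤ 21`, `m² ≤ 2⁸(Klam U)²`, from `sum_klRungProfile_compl_le ≤ 738288 < 2²⁰`) and the ALL-SCALES form **`rung_mass_le_ppGain_klEngGeo11_all`**:
  every step `n → n+1` with `n ≤ n_β` (the extended ladder's last step included), out of class at `n+1`, `m² ≤ 2⁸·(Klam U)²` (`n = 0` flat, `n ≥ 1` two-shell).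
So the un-resummed pp term of the out-of-class slice increment is IN ITS SLOT of `gainBar klEngGeo11 P U (n+1) |p_Qm|_𝕋 · ·` at every scale of the ladder, by name.
Real arithmetic over landed rows; nothing about the model's effective action is asserted; nothing asserts (E2″-F), (c), K3 or superconductivity.  0 kit · 0 lit.
-/

noncomputable section

namespace Summit.HubbardSuperconductivity.HubbardSuperconductivity.Theorems.KLRegimeSplit

set_option linter.dupNamespace false -- summit = problem name (single-conjunct summit), D-0017

open Real Finset Set Literature.MathematicalPhysics.QuantumLattice Literature.Probability.LatticeModels
open Literature.MathematicalPhysics.QuantumLattice.FermiRG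
open Summit.HubbardSuperconductivity.HubbardSuperconductivity.Theorems.KLProgrammeLegKernels
open Summit.HubbardSuperconductivity.HubbardSuperconductivity.Theorems.TwoPointAssembly
open Summit.HubbardSuperconductivity.HubbardSuperconductivity.Theorems.DispersionFlow
open Summit.HubbardSuperconductivity.HubbardSuperconductivity.Theorems.KLRegimeWick
open Summit.HubbardSuperconductivity.HubbardSuperconductivity.Theorems.EngineV8

/-! ## §3 Regime reading against `klTwoShellProfile`, the package instance, and the booking at the token `klEngGeo11` -/

section Reading

variable {L M : ℕ} [NeZero L] [NeZero M] (β μ : ℝ) (K : TrigPolyC4v) {R : RenConsts} {U : ℝ} {N : ℕ}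

omit [NeZero L] [NeZero M] in
/-- **Out of the pair class the total momentum is above the slice**: `¬IsPairClassAt Qm m ⇒ Λₘ = 4^{-m}/32 < |p_Qm|_𝕋`. -/
theorem klScale_lt_klTorusNorm_of_not_isPairClassAt {Qm : TorusSite 2 L} {m : ℕ} (hQ : ¬ IsPairClassAt L Qm m) :
    klScale klE0 m < klTorusNorm L Qm := by
  unfold IsPairClassAt at hQ
  push Not at hQ
  have h4 : 0 < ((4 : ℝ) ^ m)⁻¹ := by positivity
  calc klScale klE0 m = 1 / 32 * ((4 : ℝ) ^ m)⁻¹ := by unfold klScale klE0; ring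
    _ < ((4 : ℝ) ^ m)⁻¹ := by linarith
    _ < klTorusNorm L Qm := hQ

/-- **REGIME READING**: under `Gδ ≤ Λₙ₊₁` and `8Gβ ≤ L` (`lattice_fattening_le_of_regime`), `1 ≤ n`, and `Λₙ₊₁ ≤ |p_Qm|_𝕋` (out of class at `n+1`):
`Σ_c klRungProfile … n ψ Qm c ≤ 2¹⁰·A·klTwoShellProfile (n+1) |p_Qm|_𝕋`. -/
theorem sum_klRungProfile_le_profile {A : ℝ} {u : RenConsts → ℝ} (h : TwoShellFrameAreaAt A u) (hA : 0 ≤ A) (hR : R.WF2) (hU : 0 < U)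
    (hUu : U ≤ u R) (hμ : μ ∈ klWindowC) (hK : FrameOK R U N μ K) (hβ : 0 < β) {n : ℕ} (hn1 : 1 ≤ n) {ψ : FreqMomentum L M → ℝ}
    (hφ₀ : ∀ k, 0 ≤ ψ k + softSymbolCompl L M β μ K n (n + 1) k ∧
      ψ k + softSymbolCompl L M β μ K n (n + 1) k ≤ 1 - hubbardCutoffWeightCT L M β μ K (klScale klE0 n) k)
    (hGδ : (4 + 8 / 3 * R.Gfr 1 * U ^ 2) * (2 * π / L) ≤ klScale klE0 (n + 1)) (hGL : 8 * (4 + 8 / 3 * R.Gfr 1 * U ^ 2) * β ≤ L)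
    {Qm : TorusSite 2 L} (hQ : klScale klE0 (n + 1) ≤ klTorusNorm L Qm) :
    ∑ c, klRungProfile L M β μ K n ψ Qm c ≤ 2 ^ 10 * A * klTwoShellProfile (n + 1) (klTorusNorm L Qm) := by
  have hΛ : 0 < klScale klE0 n := klth_klScale_pos n
  have hΛ1 : 0 < klScale klE0 (n + 1) := klth_klScale_pos (n + 1)
  have hsucc : klScale klE0 (n + 1) = klScale klE0 n / 4 := klth_klScale_succ n
  have hL : (0 : ℝ) < L := by exact_mod_cast Nat.pos_of_ne_zero (NeZero.ne L)
  have hπ := Real.pi_pos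
  have hπ3 : (3 : ℝ) ≤ π := by linarith [Real.pi_gt_three]
  have hGfr : 0 ≤ R.Gfr 1 := hR.wf.2.2 1
  -- abbreviations
  set G : ℝ := 4 + 8 / 3 * R.Gfr 1 * U ^ 2 with hG
  have hG0 : 0 ≤ G := by
    have h83 : 0 ≤ 8 / 3 * R.Gfr 1 * U ^ 2 := by positivity
    rw [hG]; linarith
  set ρ : ℝ := klTorusNorm L Qm with hρ
  have hρ0 : 0 < ρ := hΛ1.trans_le hQ
  -- `2Λₙ + Gδ ≤ klE0` from `n ≥ 1` and `Gδ ≤ Λₙ₊₁`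
  have hΛle : klScale klE0 n ≤ klE0 / 4 := by
    have h1 : klScale klE0 n ≤ klScale klE0 1 := klld_klScale_anti hn1
    have h2 : klScale klE0 1 = klE0 / 4 := by unfold klScale; ring
    linarith
  have hE0 : (0 : ℝ) < klE0 := by unfold klE0; norm_num
  set E : ℝ := 2 * klScale klE0 n + G * (2 * π / L) with hEdef
  have hE9 : E ≤ 9 * klScale klE0 (n + 1) := by rw [hEdef, hsucc]; rw [hsucc] at hGδ; linarith
  have hE : E ≤ klE0 := by linarith
  have hEpos : 0 ≤ E := by rw [hEdef]; positivity
  have hmain := sum_klRungProfile_le_twoShell' β μ K h hA hR hU hUu hμ hK hβ n hφ₀ hE Qm hρ0 le_rfl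
  -- the geometric factor
  have hX : E / ρ + Real.sqrt E ≤ 9 * (klScale klE0 (n + 1) / ρ) + 3 * Real.sqrt (klScale klE0 (n + 1)) := by
    have h1 : E / ρ ≤ 9 * (klScale klE0 (n + 1) / ρ) := by
      rw [← mul_div_assoc]; exact div_le_div_of_nonneg_right hE9 hρ0.le
    have h2 : Real.sqrt E ≤ 3 * Real.sqrt (klScale klE0 (n + 1)) := by
      have h9 : Real.sqrt 9 = 3 := by rw [show (9 : ℝ) = 3 ^ 2 by norm_num, Real.sqrt_sq (by norm_num)]
      rw [← h9, ← Real.sqrt_mul (by norm_num)]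
      exact Real.sqrt_le_sqrt hE9
    linarith
  -- the lattice/thermal factor
  have hY : (10 + 2 * G * β / L) / π + 12 * G / (L * klScale klE0 n) ≤ 4 := by
    have h1 : 2 * G * β / L ≤ 1 / 4 := by rw [div_le_iff₀ hL]; linarith
    have hprod : G * (2 * π) * 4 ≤ klScale klE0 n * L := by
      have h0 := hGδ
      rw [hsucc, mul_div_assoc', div_le_iff₀ hL] at h0
      linarith
    have h2 : 12 * G / (L * klScale klE0 n) ≤ 3 / (2 * π) := by
      rw [div_le_div_iff₀ (by positivity) (by positivity)]
      linarith
    have h3 : (10 + 2 * G * β / L) / π ≤ (10 + 1 / 4) / 3 :=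
      (div_le_div_of_nonneg_right (by linarith) hπ.le).trans (div_le_div_of_nonneg_left (by norm_num) (by norm_num) hπ3)
    have h4 : 3 / (2 * π) ≤ 3 / (2 * 3) := div_le_div_of_nonneg_left (by norm_num) (by norm_num) (by linarith)
    linarith
  -- the profile dominates both laws
  have hT1 : klScale klE0 (n + 1) / ρ ≤ klTwoShellProfile (n + 1) ρ := klScale_div_le_klTwoShellProfile hQ
  have hT2 : Real.sqrt (klScale klE0 (n + 1)) ≤ klTwoShellProfile (n + 1) ρ := sqrt_klScale_le_klTwoShellProfile (n + 1) ρ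
  have hT0 : 0 ≤ klTwoShellProfile (n + 1) ρ := klTwoShellProfile_nonneg _ _
  have hX' : E / ρ + Real.sqrt E ≤ 12 * klTwoShellProfile (n + 1) ρ := by linarith
  have hX0 : 0 ≤ E / ρ + Real.sqrt E := by positivity
  have hY0 : 0 ≤ (10 + 2 * G * β / L) / π + 12 * G / (L * klScale klE0 n) := by positivity
  have hπ2 : 108 * A / π ^ 2 ≤ 12 * A := by
    rw [div_le_iff₀ (by positivity)]
    have h9 : (9 : ℝ) ≤ π ^ 2 := by nlinarith
    have := mul_le_mul_of_nonneg_left h9 (by positivity : (0 : ℝ) ≤ 12 * A)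
    linarith
  have hc0 : 0 ≤ 108 * A / π ^ 2 := by positivity
  calc ∑ c, klRungProfile L M β μ K n ψ Qm c
      ≤ 108 * A / π ^ 2 * (E / ρ + Real.sqrt E) * ((10 + 2 * G * β / L) / π + 12 * G / (L * klScale klE0 n)) := hmain
    _ ≤ 108 * A / π ^ 2 * (E / ρ + Real.sqrt E) * 4 := mul_le_mul_of_nonneg_left hY (mul_nonneg hc0 hX0)
    _ ≤ 12 * A * (12 * klTwoShellProfile (n + 1) ρ) * 4 :=
        mul_le_mul_of_nonneg_right (mul_le_mul hπ2 hX' hX0 (by positivity)) (by norm_num)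
    _ = 576 * A * klTwoShellProfile (n + 1) ρ := by ring
    _ ≤ 2 ^ 10 * A * klTwoShellProfile (n + 1) ρ := by nlinarith [mul_nonneg hA hT0]

/-- **The package instance, index form** (`A := klTS`, `u := klTSU`, `ψ = s^K_{n+1,j}`): under the regime readings and `¬IsPairClassAt Qm (n+1)`,
`Σ_c klRungProfile … n s_{n+1,j} Qm c ≤ 2¹⁰·klTS·klTwoShellProfile (n+1) |p_Qm|_𝕋`. -/
theorem sum_klRungProfile_compl_le_profile_klTS (hR : R.WF2) (hU : 0 < U) (hUu : U ≤ klTSU R) (hμ : μ ∈ klWindowC) (hK : FrameOK R U N μ K)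
    (hβ : 0 < β) {n j : ℕ} (hn1 : 1 ≤ n) (hj : n + 1 ≤ j)
    (hGδ : (4 + 8 / 3 * R.Gfr 1 * U ^ 2) * (2 * π / L) ≤ klScale klE0 (n + 1)) (hGL : 8 * (4 + 8 / 3 * R.Gfr 1 * U ^ 2) * β ≤ L)
    {Qm : TorusSite 2 L} (hQ : ¬ IsPairClassAt L Qm (n + 1)) :
    ∑ c, klRungProfile L M β μ K n (softSymbolCompl L M β μ K (n + 1) j) Qm c ≤ 2 ^ 10 * klTS * klTwoShellProfile (n + 1) (klTorusNorm L Qm) := by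
  refine sum_klRungProfile_le_profile β μ K twoShellFrameAreaAt_klTS klTS_nonneg hR hU hUu hμ hK hβ hn1 (fun k => ?_) hGδ hGL
    (klScale_lt_klTorusNorm_of_not_isPairClassAt hQ).le
  have hk := (isSoftSymbol_compl (L := L) (M := M) β μ K ((Nat.le_succ n).trans hj)).1 k
  rw [softSymbolCompl_succ_add_slice_apply β μ K n j k]
  exact hk

/-- **THE BOOKING AT THE TOKEN `klEngGeo11`**: for any a-priori kernel size `m` with `m² ≤ 2⁵⁰·(Klam U)²`, under the regime readings and out of the pair class at `n+1`,
`m²·Σ_c klRungProfile … n s_{n+1,j} Qm c ≤ (Klam U)²·klEngGeo11.ppGain (n+1) |p_Qm|_𝕋` — the un-resummed particle–particle term of the slice increment sits in the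
`ppGain` slot of `gainBar klEngGeo11 P U (n+1) |p_Qm|_𝕋 …` (`klTSA = 2⁶⁰·klTS`, `klTSA_twoShell_le_klEngGeo11_ppGain`). -/
theorem rung_mass_le_ppGain_klEngGeo11 (hR : R.WF2) (hU : 0 < U) (hUu : U ≤ klTSU R) (hμ : μ ∈ klWindowC) (hK : FrameOK R U N μ K)
    (hβ : 0 < β) {n j : ℕ} (hn1 : 1 ≤ n) (hj : n + 1 ≤ j)
    (hGδ : (4 + 8 / 3 * R.Gfr 1 * U ^ 2) * (2 * π / L) ≤ klScale klE0 (n + 1)) (hGL : 8 * (4 + 8 / 3 * R.Gfr 1 * U ^ 2) * β ≤ L)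
    {Qm : TorusSite 2 L} (hQ : ¬ IsPairClassAt L Qm (n + 1)) {P : SplitConsts} {m : ℝ} (hm : m ^ 2 ≤ 2 ^ 50 * (P.Klam * U) ^ 2) :
    m ^ 2 * ∑ c, klRungProfile L M β μ K n (softSymbolCompl L M β μ K (n + 1) j) Qm c ≤
      (P.Klam * U) ^ 2 * klEngGeo11.ppGain (n + 1) (klTorusNorm L Qm) := by
  have h1 := sum_klRungProfile_compl_le_profile_klTS (M := M) β μ K hR hU hUu hμ hK hβ hn1 hj hGδ hGL hQ
  have hT0 : 0 ≤ klTwoShellProfile (n + 1) (klTorusNorm L Qm) := klTwoShellProfile_nonneg _ _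
  have hbook := klTSA_twoShell_le_klEngGeo11_ppGain (n + 1) (klTorusNorm L Qm)
  rw [klTSA_eq] at hbook
  have hTS := klTS_nonneg
  calc m ^ 2 * ∑ c, klRungProfile L M β μ K n (softSymbolCompl L M β μ K (n + 1) j) Qm c
      ≤ m ^ 2 * (2 ^ 10 * klTS * klTwoShellProfile (n + 1) (klTorusNorm L Qm)) := mul_le_mul_of_nonneg_left h1 (sq_nonneg m)
    _ ≤ 2 ^ 50 * (P.Klam * U) ^ 2 * (2 ^ 10 * klTS * klTwoShellProfile (n + 1) (klTorusNorm L Qm)) :=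
        mul_le_mul_of_nonneg_right hm (by positivity)
    _ = (P.Klam * U) ^ 2 * (2 ^ 60 * klTS * klTwoShellProfile (n + 1) (klTorusNorm L Qm)) := by ring
    _ ≤ (P.Klam * U) ^ 2 * klEngGeo11.ppGain (n + 1) (klTorusNorm L Qm) := mul_le_mul_of_nonneg_left hbook (sq_nonneg _)

end Reading

/-! ## §4 The flat booking at the shallow scales and the ALL-SCALES form of the booking -/

section AllScales

variable {L M : ℕ} [NeZero L] [NeZero M] (β μ : ℝ) (K : TrigPolyC4v) {R : RenConsts} {U : ℝ} {N : ℕ}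

omit [NeZero L] [NeZero M] in
/-- At the shallow scales the pp slot is flat: `2²⁸ ≤ klEngGeo11.ppGain m ρ` for `m ≤ 21` (`klg6_ppGain_eq_of_le` lifted along `G6 = … = G10 ≤ G11`). -/
theorem two_pow_28_le_klEngGeo11_ppGain {m : ℕ} (hm : m ≤ 21) (ρ : ℝ) : (2 : ℝ) ^ 28 ≤ klEngGeo11.ppGain m ρ := by
  have h := klEngGeo10_ppGain_le_klEngGeo11_ppGain m ρ
  rw [klEngGeo10_ppGain, klEngGeo9_ppGain, klEngGeo8_ppGain, klEngGeo7_ppGain, klg6_ppGain_eq_of_le hm] at h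
  exact h

omit [NeZero M] in
/-- **FLAT BOOKING** (every total momentum, scales `n + 1 ≤ 21`): `m²·Σ_c klRungProfile … n s_{n+1,j} Qm c ≤ (Klam U)²·klEngGeo11.ppGain (n+1) ρ`
for `m² ≤ 2⁸·(Klam U)²` (`sum_klRungProfile_compl_le ≤ 738288 < 2²⁰`). -/
theorem rung_mass_le_ppGain_klEngGeo11_flat (hK : FrameOK R U N μ K) (hβ : klBetaMin ≤ β) (hβL : β ≤ L) {n j : ℕ} (hj : n + 1 ≤ j)
    (hn : n + 1 ≤ 21) (Qm : TorusSite 2 L) {P : SplitConsts} {m : ℝ} (hm : m ^ 2 ≤ 2 ^ 8 * (P.Klam * U) ^ 2) (ρ : ℝ) :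
    m ^ 2 * ∑ c, klRungProfile L M β μ K n (softSymbolCompl L M β μ K (n + 1) j) Qm c ≤ (P.Klam * U) ^ 2 * klEngGeo11.ppGain (n + 1) ρ := by
  have h1 := sum_klRungProfile_compl_le (M := M) β μ K hK hβ hβL hj Qm
  have h2 := two_pow_28_le_klEngGeo11_ppGain hn ρ
  have h0 : 0 ≤ ∑ c, klRungProfile L M β μ K n (softSymbolCompl L M β μ K (n + 1) j) Qm c :=
    Finset.sum_nonneg fun c _ => klRungProfile_nonneg β μ K (pos_of_klBetaMin_le hβ) n _ Qm c
  calc m ^ 2 * ∑ c, klRungProfile L M β μ K n (softSymbolCompl L M β μ K (n + 1) j) Qm c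
      ≤ 2 ^ 8 * (P.Klam * U) ^ 2 * 738288 := mul_le_mul hm h1 h0 (by positivity)
    _ ≤ (P.Klam * U) ^ 2 * 2 ^ 28 := by nlinarith [sq_nonneg (P.Klam * U)]
    _ ≤ (P.Klam * U) ^ 2 * klEngGeo11.ppGain (n + 1) ρ := mul_le_mul_of_nonneg_left h2 (sq_nonneg _)

/-- **Regime form of the two-shell booking**: `klBetaMin ≤ β`, `1 ≤ n ≤ n_β`, `8Gβ ≤ L` (⇒ `Gδ ≤ Λₙ₊₁`, `lattice_fattening_le_of_regime`). -/
theorem rung_mass_le_ppGain_klEngGeo11_of_regime (hR : R.WF2) (hU : 0 < U) (hUu : U ≤ klTSU R) (hμ : μ ∈ klWindowC) (hK : FrameOK R U N μ K)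
    (hβ : klBetaMin ≤ β) {n j : ℕ} (hn1 : 1 ≤ n) (hn : n ≤ nScales β) (hj : n + 1 ≤ j) (hGL : 8 * (4 + 8 / 3 * R.Gfr 1 * U ^ 2) * β ≤ L)
    {Qm : TorusSite 2 L} (hQ : ¬ IsPairClassAt L Qm (n + 1)) {P : SplitConsts} {m : ℝ} (hm : m ^ 2 ≤ 2 ^ 50 * (P.Klam * U) ^ 2) :
    m ^ 2 * ∑ c, klRungProfile L M β μ K n (softSymbolCompl L M β μ K (n + 1) j) Qm c ≤
      (P.Klam * U) ^ 2 * klEngGeo11.ppGain (n + 1) (klTorusNorm L Qm) := by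
  have hG0 : 0 ≤ 4 + 8 / 3 * R.Gfr 1 * U ^ 2 := by
    have : 0 ≤ 8 / 3 * R.Gfr 1 * U ^ 2 := by have := hR.wf.2.2 1; positivity
    linarith
  have hGδ := (lattice_fattening_le_of_regime hβ hG0 hGL hn1 hn).1
  exact rung_mass_le_ppGain_klEngGeo11 β μ K hR hU hUu hμ hK (pos_of_klBetaMin_le hβ) hn1 hj hGδ hGL hQ hm

/-- **ALL-SCALES BOOKING of the un-resummed pp term**: for every step `n → n+1` with `n ≤ n_β` (the extended ladder's last step included), every member
`s_{n+1,j}` (`n+1 ≤ j`), every total momentum OUT of the pair class at `n+1`, and every kernel size `m² ≤ 2⁸·(Klam U)²`: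
`m²·Σ_c klRungProfile … n s_{n+1,j} Qm c ≤ (Klam U)²·klEngGeo11.ppGain (n+1) |p_Qm|_𝕋` (`n = 0`: flat; `n ≥ 1`: two-shell). -/
theorem rung_mass_le_ppGain_klEngGeo11_all (hR : R.WF2) (hU : 0 < U) (hUu : U ≤ klTSU R) (hμ : μ ∈ klWindowC) (hK : FrameOK R U N μ K)
    (hβ : klBetaMin ≤ β) (hβL : β ≤ L) {n j : ℕ} (hn : n ≤ nScales β) (hj : n + 1 ≤ j) (hGL : 8 * (4 + 8 / 3 * R.Gfr 1 * U ^ 2) * β ≤ L)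
    {Qm : TorusSite 2 L} (hQ : ¬ IsPairClassAt L Qm (n + 1)) {P : SplitConsts} {m : ℝ} (hm : m ^ 2 ≤ 2 ^ 8 * (P.Klam * U) ^ 2) :
    m ^ 2 * ∑ c, klRungProfile L M β μ K n (softSymbolCompl L M β μ K (n + 1) j) Qm c ≤
      (P.Klam * U) ^ 2 * klEngGeo11.ppGain (n + 1) (klTorusNorm L Qm) := by
  rcases Nat.eq_zero_or_pos n with hn0 | hn1
  · subst hn0
    exact rung_mass_le_ppGain_klEngGeo11_flat β μ K hK hβ hβL hj (by norm_num) Qm hm _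
  · have hm' : m ^ 2 ≤ 2 ^ 50 * (P.Klam * U) ^ 2 := hm.trans (by nlinarith [sq_nonneg (P.Klam * U)])
    exact rung_mass_le_ppGain_klEngGeo11_of_regime β μ K hR hU hUu hμ hK hβ hn1 hn hj hGL hQ hm'

end AllScales
end Summit.HubbardSuperconductivity.HubbardSuperconductivity.Theorems.KLRegimeSplit

end
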